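import Literature.NumberTheory.Automorphic.GodementJacquetAtomsRefine
import HarnessLib

/-!
# Finiteness of the congruence classes of integral matrices, decomposition of class functions,
and the counting function of the Hecke shift

Topic `NumberTheory/Automorphic`; theorems only. Fourth support file of the discharge of
`GodementJacquet1972_local_existsUnique_hasGJLFactor` (`GodementJacquetLocal`; Godement–Jacquet,
LNM 260 (1972), Thm. 3.3 (2)), after `GodementJacquetAtoms` and `GodementJacquetAtomsRefine`.
Setting: a field `F` with a `ValuativeRel`, a uniformizing element `ϖ` with finite residue field,
`K_m = congruenceGL n |ϖ|^m`.

* `exists_finset_residues_pow`: a finite complete residue system of `𝒪` modulo `ϖ^N` (ϖ-adic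
  digits); `exists_finset_matrix_residues_pow`: the same for integral matrices modulo
  `ϖ^N M_n(𝒪)`.
* `exists_finset_sum_indicator_gjClass` (**decomposition of class functions**): a function on
  `M_n(F)` which is constant on the classes `gjClass ϖ m N ·` and vanishes off the integral
  matrices is a finite sum `∑_Y f(Y) 𝟙_{gjClass ϖ m N Y}` over integral representatives `Y` with
  pairwise disjoint classes.
* **The counting function of the shift** `X ↦ #{b : X U_b t⁻¹ ∈ C}`, `C = gjClass ϖ m N (gjPin ϖ S a)`
  under the gap condition `a_i + m ≤ N`: it is `1` on the deeper class `gjClass ϖ m (N+1) (gjPin ϖ S a)`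
  (`sum_indicator_shift_eq_one`), `0` off `C` (`sum_indicator_shift_eq_zero`), bi-`K_m`-invariant and
  invariant modulo `ϖ^{N+1}` (`sum_indicator_shift_coe_mul`, `sum_indicator_shift_mul_coe`,
  `sum_indicator_shift_add`), hence constant on the classes modulo `ϖ^{N+1}`
  (`sum_indicator_shift_eq_of_mem_gjClass`); its difference with `𝟙_C` is supported on twisted
  pinned classes with strictly more pins (`exists_morePins_of_sum_indicator_shift_sub_ne_zero`).
* Further inputs of the rationality induction: `gjTransv_injective`,
  `mem_gjClass_iff_of_mem_gjClass_of_le` (finer classes refine coarser ones),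
  `exists_mem_gjClass_add_twist` (iterated refinement of a pinned class to precision `N + j`),
  `valuation_det_of_mem_gjClass_gjPin_univ` (`|det X| = |ϖ|^{∑ a_i}` on a fully pinned class).

## References

* R. Godement, H. Jacquet, *Zeta functions of simple algebras*, LNM 260 (1972), §3
  [GodementJacquet1972].
-/

set_option autoImplicit false

noncomputable section

open scoped MatrixGroups
open Matrix ValuativeRel

namespace Literature.NumberTheory.Automorphic

variable {F : Type*} [Field F] [ValuativeRel F] {n : ℕ} {ϖ : F}

/-! ### Finite residue systems modulo `ϖ^N` -/

section Residues

/-- **ϖ-adic digits**: for a uniformizing element `ϖ` with finite residue field there is a finite set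
`R ⊆ 𝒪` such that every `x ∈ 𝒪` is congruent modulo `ϖ^N` to an element of `R`. [folklore] -/
theorem exists_finset_residues_pow [Finite 𝓀[F]] (hϖ : IsUniformizingElement ϖ) (N : ℕ) :
    ∃ R : Finset F, (∀ r ∈ R, r ∈ 𝒪[F]) ∧
      ∀ x ∈ 𝒪[F], ∃ r ∈ R, valuation F (x - r) ≤ valuation F ϖ ^ N := by
  classical
  haveI := Fintype.ofFinite 𝓀[F]
  induction N with
  | zero =>
    refine ⟨{0}, by simp, fun x hx => ⟨0, Finset.mem_singleton_self _, ?_⟩⟩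
    rw [sub_zero, pow_zero]
    exact (Valuation.mem_integer_iff _ _).mp hx
  | succ N ih =>
    obtain ⟨R, hR, hcomplete⟩ := ih
    refine ⟨(R ×ˢ (Finset.univ : Finset 𝓀[F])).image fun p => p.1 + ϖ ^ N * ((liftRes p.2 : 𝒪[F]) : F),
      ?_, ?_⟩
    · intro r hr
      obtain ⟨⟨r₀, c⟩, hp, rfl⟩ := Finset.mem_image.mp hr
      exact Subring.add_mem _ (hR r₀ (Finset.mem_product.mp hp).1)
        (Subring.mul_mem _ (hϖ.pow_mem N) (SetLike.coe_mem _))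
    · intro x hx
      obtain ⟨r, hr, hxr⟩ := hcomplete x hx
      -- `y = (x - r) / ϖ^N ∈ 𝒪`, with residue `c`
      have hpow : ϖ ^ N ≠ 0 := pow_ne_zero _ hϖ.ne_zero
      have hv : valuation F ϖ ^ N ≠ 0 := valuation_pow_ne_zero' hϖ.ne_zero N
      set y : F := (ϖ ^ N)⁻¹ * (x - r) with hy
      have hyint : y ∈ 𝒪[F] := by
        rw [Valuation.mem_integer_iff, hy, map_mul, map_inv₀, map_pow]
        calc (valuation F ϖ ^ N)⁻¹ * valuation F (x - r) ≤ (valuation F ϖ ^ N)⁻¹ * valuation F ϖ ^ N :=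
              mul_le_mul_right hxr _
          _ = 1 := inv_mul_cancel₀ hv
      set c : 𝓀[F] := IsLocalRing.residue 𝒪[F] ⟨y, hyint⟩ with hc
      refine ⟨r + ϖ ^ N * ((liftRes c : 𝒪[F]) : F), Finset.mem_image.mpr ⟨(r, c),
        Finset.mem_product.mpr ⟨hr, Finset.mem_univ _⟩, rfl⟩, ?_⟩
      have e : x - (r + ϖ ^ N * ((liftRes c : 𝒪[F]) : F)) = ϖ ^ N * (y - ((liftRes c : 𝒪[F]) : F)) := by
        rw [hy, mul_sub, ← mul_assoc, mul_inv_cancel₀ hpow, one_mul]; ring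
      have hres : valuation F (y - ((liftRes c : 𝒪[F]) : F)) ≤ valuation F ϖ := by
        have h := (residue_eq_residue_iff hϖ ⟨y, hyint⟩ (liftRes c)).mp (by rw [residue_liftRes])
        exact h
      rw [e, map_mul, map_pow, pow_succ]
      exact mul_le_mul' le_rfl hres

/-- **Integral matrices modulo `ϖ^N M_n(𝒪)`**: a finite set of integral matrices meeting every class
`X + ϖ^N M_n(𝒪)`, `X` integral. [folklore] -/
theorem exists_finset_matrix_residues_pow [Finite 𝓀[F]] (hϖ : IsUniformizingElement ϖ) (N : ℕ) :
    ∃ T : Finset (Matrix (Fin n) (Fin n) F), (∀ Y ∈ T, IsIntegralMatrix Y) ∧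
      ∀ X : Matrix (Fin n) (Fin n) F, IsIntegralMatrix X →
        ∃ Y ∈ T, ValBound (valuation F ϖ ^ N) (X - Y) := by
  classical
  obtain ⟨R, hR, hcomplete⟩ := exists_finset_residues_pow hϖ N
  refine ⟨(Fintype.piFinset fun _ : Fin n => Fintype.piFinset fun _ : Fin n => R).image Matrix.of,
    ?_, ?_⟩
  · intro Y hY
    obtain ⟨f, hf, rfl⟩ := Finset.mem_image.mp hY
    intro i j
    exact hR _ (Fintype.mem_piFinset.mp (Fintype.mem_piFinset.mp hf i) j)
  · intro X hX
    choose r hr hrv using fun i j => hcomplete (X i j) (hX i j)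
    refine ⟨Matrix.of fun i j => r i j, Finset.mem_image.mpr ⟨fun i j => r i j,
      Fintype.mem_piFinset.mpr fun i => Fintype.mem_piFinset.mpr fun j => hr i j, rfl⟩, fun i j => ?_⟩
    rw [Matrix.sub_apply, Matrix.of_apply]
    exact hrv i j

/-- **The classes of integral matrices are finite in number**: a finite set of integral matrices
whose classes `gjClass ϖ m N ·` contain every integral matrix. [folklore] -/
theorem exists_finset_forall_mem_gjClass [Finite 𝓀[F]] (hϖ : IsUniformizingElement ϖ) (m N : ℕ) :
    ∃ T : Finset (Matrix (Fin n) (Fin n) F), (∀ Y ∈ T, IsIntegralMatrix Y) ∧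
      ∀ X : Matrix (Fin n) (Fin n) F, IsIntegralMatrix X → ∃ Y ∈ T, X ∈ gjClass ϖ m N Y := by
  obtain ⟨T, hT, hcomplete⟩ := exists_finset_matrix_residues_pow hϖ N
  refine ⟨T, hT, fun X hX => ?_⟩
  obtain ⟨Y, hY, h⟩ := hcomplete X hX
  exact ⟨Y, hY, mem_gjClass_of_valBound_sub h⟩

end Residues

/-! ### Decomposition of class functions -/

section Decomposition

variable {m N : ℕ}

/-- **Decomposition of a class function into indicator functions of classes.** Let `f` be a
function on `M_n(F)` with values in an additive commutative group which is constant on each class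
`gjClass ϖ m N Y` and vanishes off the integral matrices. Then there is a finite set `ι` of integral
matrices with pairwise disjoint (indeed distinct) classes such that
`f = ∑_{Y ∈ ι} f(Y) · 𝟙_{gjClass ϖ m N Y}`. [folklore] -/
theorem exists_finset_sum_indicator_gjClass [Finite 𝓀[F]] (hϖ : IsUniformizingElement ϖ)
    {M : Type*} [AddCommGroup M] {f : Matrix (Fin n) (Fin n) F → M}
    (hclass : ∀ X Y, X ∈ gjClass ϖ m N Y → f X = f Y)
    (hsupp : ∀ X, f X ≠ 0 → IsIntegralMatrix X) :
    ∃ ι : Finset (Matrix (Fin n) (Fin n) F), (∀ Y ∈ ι, IsIntegralMatrix Y) ∧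
      (∀ Y ∈ ι, ∀ Y' ∈ ι, Y ≠ Y' → Disjoint (gjClass ϖ m N Y) (gjClass ϖ m N Y')) ∧
      ∀ X, f X = ∑ Y ∈ ι, (gjClass ϖ m N Y).indicator (fun _ => f Y) X := by
  classical
  have hϖle : valuation F ϖ ≤ 1 := hϖ.valuation_le_one
  obtain ⟨T, hT, hcomplete⟩ := exists_finset_forall_mem_gjClass (n := n) hϖ m N
  -- the finite set of classes and a representative of each
  set 𝒞 : Finset (Set (Matrix (Fin n) (Fin n) F)) := T.image (gjClass ϖ m N) with h𝒞
  have hrep : ∀ C ∈ 𝒞, ∃ Y ∈ T, gjClass ϖ m N Y = C := fun C hC => by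
    obtain ⟨Y, hY, rfl⟩ := Finset.mem_image.mp hC
    exact ⟨Y, hY, rfl⟩
  choose! rep hrepT hrepC using hrep
  set ι : Finset (Matrix (Fin n) (Fin n) F) := 𝒞.image rep with hι
  have hrep_inj : Set.InjOn rep 𝒞 := fun C hC C' hC' h => by rw [← hrepC C hC, ← hrepC C' hC', h]
  refine ⟨ι, fun Y hY => ?_, fun Y hY Y' hY' hne => ?_, fun X => ?_⟩
  · obtain ⟨C, hC, rfl⟩ := Finset.mem_image.mp hY
    exact hT _ (hrepT C hC)
  · obtain ⟨C, hC, rfl⟩ := Finset.mem_image.mp hY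
    obtain ⟨C', hC', rfl⟩ := Finset.mem_image.mp hY'
    rw [Set.disjoint_iff]
    rintro X ⟨hX, hX'⟩
    exact hne (by rw [hrep_inj hC hC' (by rw [← hrepC C hC, ← hrepC C' hC',
      gjClass_eq_of_mem_of_mem hX hX'])])
  · rw [hι, Finset.sum_image hrep_inj]
    by_cases hX : IsIntegralMatrix X
    · -- exactly one class of `𝒞` contains `X`
      obtain ⟨Y₀, hY₀, hXY₀⟩ := hcomplete X hX
      have hC₀ : gjClass ϖ m N Y₀ ∈ 𝒞 := Finset.mem_image_of_mem _ hY₀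
      rw [Finset.sum_eq_single_of_mem (gjClass ϖ m N Y₀) hC₀]
      · rw [Set.indicator_of_mem (by rw [hrepC _ hC₀]; exact hXY₀)]
        refine hclass X _ ?_
        rw [hrepC _ hC₀]
        exact hXY₀
      · intro C hC hne
        obtain ⟨Y, hY, rfl⟩ := Finset.mem_image.mp hC
        rw [Set.indicator_of_notMem]
        intro hXC
        rw [hrepC _ hC] at hXC
        exact hne (gjClass_eq_of_mem_of_mem hXC hXY₀)
    · -- `X` is not integral: everything vanishes
      have hfX : f X = 0 := by by_contra h; exact hX (hsupp X h)
      rw [hfX]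
      symm
      refine Finset.sum_eq_zero fun C hC => ?_
      rw [Set.indicator_of_notMem]
      intro hXC
      rw [hrepC C hC] at hXC
      obtain ⟨Y, hY, rfl⟩ := Finset.mem_image.mp hC
      exact hX fun i j => (Valuation.mem_integer_iff _ _).mpr
        (valBound_one_of_mem_gjClass hϖle (fun i j => (Valuation.mem_integer_iff _ _).mp (hT Y hY i j)) hXC i j)

end Decomposition

/-! ### The counting function of the Hecke shift -/

section ShiftCount

variable {m N : ℕ} {S : Finset (Fin n)} {a : Fin n → ℕ} {R : Type*} [NonAssocSemiring R]

omit [Field F] [ValuativeRel F] in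
/-- Indicator functions of a class agree at two points which are simultaneously in or out.
[folklore] -/
theorem indicator_one_congr_mem {C : Set (Matrix (Fin n) (Fin n) F)} {X X' : Matrix (Fin n) (Fin n) F}
    (h : X ∈ C ↔ X' ∈ C) :
    C.indicator (1 : Matrix (Fin n) (Fin n) F → R) X = C.indicator (1 : Matrix (Fin n) (Fin n) F → R) X' := by
  by_cases hX : X ∈ C
  · rw [Set.indicator_of_mem hX, Set.indicator_of_mem (h.mp hX), Pi.one_apply, Pi.one_apply]
  · rw [Set.indicator_of_notMem hX, Set.indicator_of_notMem (fun h' => hX (h.mpr h'))]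

variable [Fintype 𝓀[F]]

/-- **The count is `1` on the deeper class**: for `X ∈ gjClass ϖ m (N+1) (gjPin ϖ S a)` (gap
`a_i + m ≤ N`, `m ≥ 1`), exactly one shift `X U_b t⁻¹` lies in `gjClass ϖ m N (gjPin ϖ S a)`.
[folklore] -/
theorem sum_indicator_shift_eq_one (hϖ : IsUniformizingElement ϖ) (hm : 1 ≤ m)
    (hgap : ∀ i ∈ S, a i + m ≤ N) {X : Matrix (Fin n) (Fin n) F}
    (hX : X ∈ gjClass ϖ m (N + 1) (gjPin ϖ S a)) :
    ∑ b : ({i : Fin n // i ∈ S} × {j : Fin n // j ∉ S} → 𝓀[F]),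
      (gjClass ϖ m N (gjPin ϖ S a)).indicator (1 : Matrix (Fin n) (Fin n) F → R)
        (X * ((gjTransv hϖ hm S b : GL (Fin n) F) : Matrix (Fin n) (Fin n) F) *
          (((gjShift hϖ.ne_zero S)⁻¹ : GL (Fin n) F) : Matrix (Fin n) (Fin n) F)) = 1 := by
  classical
  obtain ⟨b₀, hb₀⟩ := exists_forall_mul_gjTransv_mul_shift_inv_mem_gjClass_iff hϖ hm hgap hX
  rw [Finset.sum_eq_single b₀]
  · rw [Set.indicator_of_mem ((hb₀ b₀).mpr rfl), Pi.one_apply]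
  · intro b _ hb
    rw [Set.indicator_of_notMem (fun h => hb ((hb₀ b).mp h))]
  · intro h; exact absurd (Finset.mem_univ b₀) h

omit [Fintype 𝓀[F]] in
/-- **The count vanishes off the class.** [folklore] -/
theorem sum_indicator_shift_eq_zero [Fintype 𝓀[F]] (hϖ : IsUniformizingElement ϖ) (hm : 1 ≤ m)
    {X : Matrix (Fin n) (Fin n) F} (hX : X ∉ gjClass ϖ m N (gjPin ϖ S a)) :
    ∑ b : ({i : Fin n // i ∈ S} × {j : Fin n // j ∉ S} → 𝓀[F]),
      (gjClass ϖ m N (gjPin ϖ S a)).indicator (1 : Matrix (Fin n) (Fin n) F → R)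
        (X * ((gjTransv hϖ hm S b : GL (Fin n) F) : Matrix (Fin n) (Fin n) F) *
          (((gjShift hϖ.ne_zero S)⁻¹ : GL (Fin n) F) : Matrix (Fin n) (Fin n) F)) = 0 :=
  Finset.sum_eq_zero fun b _ =>
    Set.indicator_of_notMem (mul_gjTransv_mul_shift_inv_not_mem_gjClass hϖ hm hX b) _

/-- **Left `K_m`-invariance of the count** (any class `C`, by left invariance of the classes).
[folklore] -/
theorem sum_indicator_shift_coe_mul (hϖ : IsUniformizingElement ϖ) (hm : 1 ≤ m)
    (Y : Matrix (Fin n) (Fin n) F) {k : GL (Fin n) F} (hk : k ∈ congruenceGL n (valuation F ϖ ^ m))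
    (X : Matrix (Fin n) (Fin n) F) :
    ∑ b : ({i : Fin n // i ∈ S} × {j : Fin n // j ∉ S} → 𝓀[F]),
      (gjClass ϖ m N Y).indicator (1 : Matrix (Fin n) (Fin n) F → R)
        ((k : Matrix (Fin n) (Fin n) F) * X * ((gjTransv hϖ hm S b : GL (Fin n) F) : Matrix (Fin n) (Fin n) F) *
          (((gjShift hϖ.ne_zero S)⁻¹ : GL (Fin n) F) : Matrix (Fin n) (Fin n) F)) =
    ∑ b : ({i : Fin n // i ∈ S} × {j : Fin n // j ∉ S} → 𝓀[F]),
      (gjClass ϖ m N Y).indicator (1 : Matrix (Fin n) (Fin n) F → R)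
        (X * ((gjTransv hϖ hm S b : GL (Fin n) F) : Matrix (Fin n) (Fin n) F) *
          (((gjShift hϖ.ne_zero S)⁻¹ : GL (Fin n) F) : Matrix (Fin n) (Fin n) F)) := by
  refine Finset.sum_congr rfl fun b _ => indicator_one_congr_mem ?_
  rw [Matrix.mul_assoc, Matrix.mul_assoc, coe_mul_mem_gjClass_iff hk, ← Matrix.mul_assoc]

/-- **Right `K_m`-invariance of the count** (any class, via the transversal property of the `U_b`,
`exists_equiv_mul_gjTransv_mem_gjClass_iff`). [folklore] -/
theorem sum_indicator_shift_mul_coe (hϖ : IsUniformizingElement ϖ) (hm : 1 ≤ m)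
    (Y : Matrix (Fin n) (Fin n) F) {k : GL (Fin n) F} (hk : k ∈ congruenceGL n (valuation F ϖ ^ m))
    (X : Matrix (Fin n) (Fin n) F) :
    ∑ b : ({i : Fin n // i ∈ S} × {j : Fin n // j ∉ S} → 𝓀[F]),
      (gjClass ϖ m N Y).indicator (1 : Matrix (Fin n) (Fin n) F → R)
        (X * (k : Matrix (Fin n) (Fin n) F) * ((gjTransv hϖ hm S b : GL (Fin n) F) : Matrix (Fin n) (Fin n) F) *
          (((gjShift hϖ.ne_zero S)⁻¹ : GL (Fin n) F) : Matrix (Fin n) (Fin n) F)) =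
    ∑ b : ({i : Fin n // i ∈ S} × {j : Fin n // j ∉ S} → 𝓀[F]),
      (gjClass ϖ m N Y).indicator (1 : Matrix (Fin n) (Fin n) F → R)
        (X * ((gjTransv hϖ hm S b : GL (Fin n) F) : Matrix (Fin n) (Fin n) F) *
          (((gjShift hϖ.ne_zero S)⁻¹ : GL (Fin n) F) : Matrix (Fin n) (Fin n) F)) := by
  obtain ⟨π, hπ⟩ := exists_equiv_mul_gjTransv_mem_gjClass_iff (S := S) hϖ hm hk
  calc ∑ b : ({i : Fin n // i ∈ S} × {j : Fin n // j ∉ S} → 𝓀[F]),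
        (gjClass ϖ m N Y).indicator (1 : Matrix (Fin n) (Fin n) F → R)
          (X * (k : Matrix (Fin n) (Fin n) F) * ((gjTransv hϖ hm S b : GL (Fin n) F) : Matrix (Fin n) (Fin n) F) *
            (((gjShift hϖ.ne_zero S)⁻¹ : GL (Fin n) F) : Matrix (Fin n) (Fin n) F))
      = ∑ b : ({i : Fin n // i ∈ S} × {j : Fin n // j ∉ S} → 𝓀[F]),
        (gjClass ϖ m N Y).indicator (1 : Matrix (Fin n) (Fin n) F → R)
          (X * ((gjTransv hϖ hm S (π b) : GL (Fin n) F) : Matrix (Fin n) (Fin n) F) *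
            (((gjShift hϖ.ne_zero S)⁻¹ : GL (Fin n) F) : Matrix (Fin n) (Fin n) F)) := by
        refine Finset.sum_congr rfl fun b _ => indicator_one_congr_mem ?_
        rw [← hπ N Y X b, Units.val_mul, Matrix.mul_assoc X (k : Matrix (Fin n) (Fin n) F)]
    _ = _ := Equiv.sum_comp π (fun b => (gjClass ϖ m N Y).indicator (1 : Matrix (Fin n) (Fin n) F → R)
          (X * ((gjTransv hϖ hm S b : GL (Fin n) F) : Matrix (Fin n) (Fin n) F) *
            (((gjShift hϖ.ne_zero S)⁻¹ : GL (Fin n) F) : Matrix (Fin n) (Fin n) F)))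

/-- **Invariance of the count modulo `ϖ^{N+1}`** (for the class at precision `N`): the shifts of `E`
with `|E| ≤ |ϖ|^{N+1}` have entries of valuation `≤ |ϖ|^N`. [folklore] -/
theorem sum_indicator_shift_add (hϖ : IsUniformizingElement ϖ) (hm : 1 ≤ m)
    (Y : Matrix (Fin n) (Fin n) F) {E : Matrix (Fin n) (Fin n) F}
    (hE : ValBound (valuation F ϖ ^ (N + 1)) E) (X : Matrix (Fin n) (Fin n) F) :
    ∑ b : ({i : Fin n // i ∈ S} × {j : Fin n // j ∉ S} → 𝓀[F]),
      (gjClass ϖ m N Y).indicator (1 : Matrix (Fin n) (Fin n) F → R)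
        ((X + E) * ((gjTransv hϖ hm S b : GL (Fin n) F) : Matrix (Fin n) (Fin n) F) *
          (((gjShift hϖ.ne_zero S)⁻¹ : GL (Fin n) F) : Matrix (Fin n) (Fin n) F)) =
    ∑ b : ({i : Fin n // i ∈ S} × {j : Fin n // j ∉ S} → 𝓀[F]),
      (gjClass ϖ m N Y).indicator (1 : Matrix (Fin n) (Fin n) F → R)
        (X * ((gjTransv hϖ hm S b : GL (Fin n) F) : Matrix (Fin n) (Fin n) F) *
          (((gjShift hϖ.ne_zero S)⁻¹ : GL (Fin n) F) : Matrix (Fin n) (Fin n) F)) := by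
  refine Finset.sum_congr rfl fun b _ => indicator_one_congr_mem ?_
  have hsmall : ValBound (valuation F ϖ ^ N)
      (E * ((gjTransv hϖ hm S b : GL (Fin n) F) : Matrix (Fin n) (Fin n) F) *
        (((gjShift hϖ.ne_zero S)⁻¹ : GL (Fin n) F) : Matrix (Fin n) (Fin n) F)) := by
    have h1 := (hE.mul (valBound_one_coe_of_mem_congruenceGL (gjTransv_mem_congruenceGL hϖ hm b))).mul
      (valBound_coe_gjShift_inv hϖ S)
    rw [mul_one] at h1
    refine h1.mono (le_of_eq ?_)
    rw [pow_succ, mul_assoc, mul_inv_cancel₀ ((Valuation.ne_zero_iff _).mpr hϖ.ne_zero), mul_one]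
  rw [Matrix.add_mul, Matrix.add_mul, add_mem_gjClass_iff hsmall]

/-- **The count is a class function modulo `ϖ^{N+1}`.** [folklore] -/
theorem sum_indicator_shift_eq_of_mem_gjClass (hϖ : IsUniformizingElement ϖ) (hm : 1 ≤ m)
    (Y : Matrix (Fin n) (Fin n) F) {X X₀ : Matrix (Fin n) (Fin n) F}
    (hX : X ∈ gjClass ϖ m (N + 1) X₀) :
    ∑ b : ({i : Fin n // i ∈ S} × {j : Fin n // j ∉ S} → 𝓀[F]),
      (gjClass ϖ m N Y).indicator (1 : Matrix (Fin n) (Fin n) F → R)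
        (X * ((gjTransv hϖ hm S b : GL (Fin n) F) : Matrix (Fin n) (Fin n) F) *
          (((gjShift hϖ.ne_zero S)⁻¹ : GL (Fin n) F) : Matrix (Fin n) (Fin n) F)) =
    ∑ b : ({i : Fin n // i ∈ S} × {j : Fin n // j ∉ S} → 𝓀[F]),
      (gjClass ϖ m N Y).indicator (1 : Matrix (Fin n) (Fin n) F → R)
        (X₀ * ((gjTransv hϖ hm S b : GL (Fin n) F) : Matrix (Fin n) (Fin n) F) *
          (((gjShift hϖ.ne_zero S)⁻¹ : GL (Fin n) F) : Matrix (Fin n) (Fin n) F)) := by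
  obtain ⟨k, hk, k', hk', h⟩ := hX
  have e : X = (k : Matrix (Fin n) (Fin n) F) * (X₀ * (k' : Matrix (Fin n) (Fin n) F)) +
      (X - (k : Matrix (Fin n) (Fin n) F) * X₀ * (k' : Matrix (Fin n) (Fin n) F)) := by
    rw [Matrix.mul_assoc]; abel
  rw [e, sum_indicator_shift_add hϖ hm Y h, sum_indicator_shift_coe_mul hϖ hm Y hk,
    sum_indicator_shift_mul_coe hϖ hm Y hk']

/-- **The support of `count - 𝟙_C` has more pins.** Under the gap condition, if the difference of the
count and the indicator of `C = gjClass ϖ m N (gjPin ϖ S a)` does not vanish at `X`, then `X ∈ C` but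
`X ∉ gjClass ϖ m (N+1) (gjPin ϖ S a)`, hence `X` lies in the class modulo `ϖ^{N+1}` of a twisted
pinned matrix with strictly more pins (`mem_gjClass_succ_or_morePins`). [folklore] -/
theorem exists_morePins_of_sum_indicator_shift_sub_ne_zero {R' : Type*} [NonAssocRing R']
    (hϖ : IsUniformizingElement ϖ) (hm : 1 ≤ m) (hgap : ∀ i ∈ S, a i + m ≤ N)
    {X : Matrix (Fin n) (Fin n) F}
    (hX : (∑ b : ({i : Fin n // i ∈ S} × {j : Fin n // j ∉ S} → 𝓀[F]),
      (gjClass ϖ m N (gjPin ϖ S a)).indicator (1 : Matrix (Fin n) (Fin n) F → R')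
        (X * ((gjTransv hϖ hm S b : GL (Fin n) F) : Matrix (Fin n) (Fin n) F) *
          (((gjShift hϖ.ne_zero S)⁻¹ : GL (Fin n) F) : Matrix (Fin n) (Fin n) F))) -
      (gjClass ϖ m N (gjPin ϖ S a)).indicator (1 : Matrix (Fin n) (Fin n) F → R') X ≠ 0) :
    X ∈ gjClass ϖ m N (gjPin ϖ S a) ∧ X ∉ gjClass ϖ m (N + 1) (gjPin ϖ S a) ∧
      ∃ κ κ' : GL (Fin n) F, κ ∈ glInt n F ∧ κ' ∈ glInt n F ∧ ∃ T : Finset (Fin n), T.Nonempty ∧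
        (∀ i ∈ T, i ∉ S) ∧
        X ∈ gjClass ϖ m (N + 1)
          ((κ : Matrix (Fin n) (Fin n) F) * gjPin ϖ (S ∪ T) (fun i => if i ∈ S then a i else N) *
            (κ' : Matrix (Fin n) (Fin n) F)) := by
  have hmem : X ∈ gjClass ϖ m N (gjPin ϖ S a) := by
    by_contra h
    rw [sum_indicator_shift_eq_zero hϖ hm h, Set.indicator_of_notMem h, sub_zero] at hX
    exact hX rfl
  have hnot : X ∉ gjClass ϖ m (N + 1) (gjPin ϖ S a) := by
    intro h
    rw [sum_indicator_shift_eq_one hϖ hm hgap h, Set.indicator_of_mem hmem, Pi.one_apply, sub_self] at hX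
    exact hX rfl
  refine ⟨hmem, hnot, ?_⟩
  rcases mem_gjClass_succ_or_morePins hϖ hm hgap hmem with h | h
  · exact absurd h hnot
  · exact h

end ShiftCount

/-! ### Further algebraic inputs of the rationality induction -/

section Inputs

variable {m N : ℕ} {S : Finset (Fin n)} {a : Fin n → ℕ}

/-- **The transversal elements are pairwise distinct**: `b ↦ U_b` is injective. [folklore] -/
theorem gjTransv_injective (hϖ : IsUniformizingElement ϖ) (hm : 1 ≤ m) :
    Function.Injective (gjTransv (n := n) hϖ hm S) := by
  intro b b' h
  have hmat : gjTransvMatrix S b = gjTransvMatrix S b' := by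
    have h1 := congrArg (fun U : GL (Fin n) F => (U : Matrix (Fin n) (Fin n) F)) h
    simp only [coe_gjTransv, add_right_inj] at h1
    exact smul_right_injective _ (pow_ne_zero _ hϖ.ne_zero) h1
  funext ⟨⟨i, hi⟩, ⟨j, hj⟩⟩
  have h2 := congrFun (congrFun hmat i) j
  rw [gjTransvMatrix_apply, gjTransvMatrix_apply, dif_pos ⟨hi, hj⟩, dif_pos ⟨hi, hj⟩] at h2
  have h3 : liftRes (b (⟨i, hi⟩, ⟨j, hj⟩)) = liftRes (b' (⟨i, hi⟩, ⟨j, hj⟩)) := Subtype.ext h2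
  have h4 := congrArg (IsLocalRing.residue 𝒪[F]) h3
  rwa [residue_liftRes, residue_liftRes] at h4

/-- **Classes at a finer precision are contained in classes at a coarser one**: for
`X ∈ gjClass ϖ m N' Y` and `N ≤ N'`, `X` and `Y` lie in the same classes modulo `ϖ^N`. [folklore] -/
theorem mem_gjClass_iff_of_mem_gjClass_of_le (hϖ : valuation F ϖ ≤ 1) {N' : ℕ} (hN : N ≤ N')
    {X Y : Matrix (Fin n) (Fin n) F} (hX : X ∈ gjClass ϖ m N' Y) (Z : Matrix (Fin n) (Fin n) F) :
    X ∈ gjClass ϖ m N Z ↔ Y ∈ gjClass ϖ m N Z := by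
  have hX' : X ∈ gjClass ϖ m N Y := gjClass_mono_precision hϖ hN Y hX
  exact ⟨fun h => mem_gjClass_trans h (mem_gjClass_symm hX'), fun h => mem_gjClass_trans h hX'⟩

/-- **Iterated refinement of a pinned class**: a member of `gjClass ϖ m N (gjPin ϖ S a)` (`a_i < N` on
`S`) lies, for every `j`, in the class modulo `ϖ^{N+j}` of a twist `κ D' κ'` (`κ, κ' ∈ GL_n(𝒪)`) of a
pinned matrix `D' = gjPin ϖ (S ∪ T) a'` with `T ⊆ Sᶜ`, `a' = a` on `S` and `a' < N + j` on `S ∪ T`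
(iterate `exists_mem_gjClass_succ_twist`). [folklore] -/
theorem exists_mem_gjClass_add_twist (hϖ : IsUniformizingElement ϖ) {X : Matrix (Fin n) (Fin n) F}
    (hX : X ∈ gjClass ϖ m N (gjPin ϖ S a)) (ha : ∀ i ∈ S, a i < N) (j : ℕ) :
    ∃ κ κ' : GL (Fin n) F, κ ∈ glInt n F ∧ κ' ∈ glInt n F ∧ ∃ T : Finset (Fin n), (∀ i ∈ T, i ∉ S) ∧
      ∃ a' : Fin n → ℕ, (∀ i ∈ S, a' i = a i) ∧ (∀ i ∈ S ∪ T, a' i < N + j) ∧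
        X ∈ gjClass ϖ m (N + j)
          ((κ : Matrix (Fin n) (Fin n) F) * gjPin ϖ (S ∪ T) a' * (κ' : Matrix (Fin n) (Fin n) F)) := by
  induction j with
  | zero =>
    refine ⟨1, 1, Subgroup.one_mem _, Subgroup.one_mem _, ∅, by simp, a, fun _ _ => rfl, ?_, ?_⟩
    · intro i hi
      rw [Finset.union_empty] at hi
      exact ha i hi
    · rw [Finset.union_empty, Units.val_one, Matrix.one_mul, Matrix.mul_one, add_zero]
      exact hX
  | succ j ih =>
    obtain ⟨κ, κ', hκ, hκ', T, hTS, a', ha'S, ha'lt, hmem⟩ := ih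
    -- untwist
    have hmem' : ((κ⁻¹ : GL (Fin n) F) : Matrix (Fin n) (Fin n) F) * X *
        ((κ'⁻¹ : GL (Fin n) F) : Matrix (Fin n) (Fin n) F) ∈ gjClass ϖ m (N + j) (gjPin ϖ (S ∪ T) a') := by
      rw [← mul_mul_mem_gjClass_iff hκ hκ']
      have e : (κ : Matrix (Fin n) (Fin n) F) * (((κ⁻¹ : GL (Fin n) F) : Matrix (Fin n) (Fin n) F) * X *
          ((κ'⁻¹ : GL (Fin n) F) : Matrix (Fin n) (Fin n) F)) * (κ' : Matrix (Fin n) (Fin n) F) = X := by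
        rw [← Matrix.mul_assoc, ← Matrix.mul_assoc, ← Units.val_mul, mul_inv_cancel, Units.val_one,
          Matrix.one_mul, Matrix.mul_assoc, ← Units.val_mul, inv_mul_cancel, Units.val_one, Matrix.mul_one]
      rw [e]; exact hmem
    -- refine by one step
    obtain ⟨κ₂, κ₂', hκ₂, hκ₂', T₂, hT₂, h2⟩ := exists_mem_gjClass_succ_twist hϖ ha'lt hmem'
    -- twist back
    rw [← mul_mul_mem_gjClass_iff hκ hκ'] at h2
    have e1 : (κ : Matrix (Fin n) (Fin n) F) * (((κ⁻¹ : GL (Fin n) F) : Matrix (Fin n) (Fin n) F) * X *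
        ((κ'⁻¹ : GL (Fin n) F) : Matrix (Fin n) (Fin n) F)) * (κ' : Matrix (Fin n) (Fin n) F) = X := by
      rw [← Matrix.mul_assoc, ← Matrix.mul_assoc, ← Units.val_mul, mul_inv_cancel, Units.val_one,
        Matrix.one_mul, Matrix.mul_assoc, ← Units.val_mul, inv_mul_cancel, Units.val_one, Matrix.mul_one]
    rw [e1] at h2
    refine ⟨κ * κ₂, κ₂' * κ', Subgroup.mul_mem _ hκ hκ₂, Subgroup.mul_mem _ hκ₂' hκ', T ∪ T₂, ?_,
      fun i => if i ∈ S ∪ T then a' i else N + j, ?_, ?_, ?_⟩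
    · intro i hi
      rcases Finset.mem_union.mp hi with h | h
      · exact hTS i h
      · exact fun hiS => hT₂ i h (Finset.mem_union_left _ hiS)
    · intro i hi
      show (if i ∈ S ∪ T then a' i else N + j) = a i
      rw [if_pos (Finset.mem_union_left _ hi)]
      exact ha'S i hi
    · intro i hi
      show (if i ∈ S ∪ T then a' i else N + j) < N + (j + 1)
      by_cases h : i ∈ S ∪ T
      · rw [if_pos h]; exact (ha'lt i h).trans (Nat.lt_succ_self _)
      · rw [if_neg h]; exact Nat.lt_succ_self _
    · have e2 : (κ : Matrix (Fin n) (Fin n) F) * ((κ₂ : Matrix (Fin n) (Fin n) F) *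
          gjPin ϖ (S ∪ T ∪ T₂) (fun i => if i ∈ S ∪ T then a' i else N + j) *
          (κ₂' : Matrix (Fin n) (Fin n) F)) * (κ' : Matrix (Fin n) (Fin n) F) =
          ((κ * κ₂ : GL (Fin n) F) : Matrix (Fin n) (Fin n) F) *
            gjPin ϖ (S ∪ (T ∪ T₂)) (fun i => if i ∈ S ∪ T then a' i else N + j) *
            ((κ₂' * κ' : GL (Fin n) F) : Matrix (Fin n) (Fin n) F) := by
        simp only [Units.val_mul, Matrix.mul_assoc, Finset.union_assoc]
      rw [e2] at h2
      exact h2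

/-- **Determinant of a fully pinned class**: for `X` in the class modulo `ϖ^N` of a twist of
`gjPin ϖ univ a` with `a_i < N`, `|det X| = |ϖ|^{∑ a_i}` (write `X = P₁ (D + E₁) P₂`,
`D + E₁ = D (1 + D⁻¹ E₁)` with `|D⁻¹ E₁| ≤ |ϖ| < 1`). [folklore] -/
theorem valuation_det_of_mem_gjClass_gjPin_univ (hϖ : IsUniformizingElement ϖ)
    {κ κ' : GL (Fin n) F} (hκ : κ ∈ glInt n F) (hκ' : κ' ∈ glInt n F) (ha : ∀ i, a i < N)
    {X : Matrix (Fin n) (Fin n) F}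
    (hX : X ∈ gjClass ϖ m N ((κ : Matrix (Fin n) (Fin n) F) * gjPin ϖ Finset.univ a *
      (κ' : Matrix (Fin n) (Fin n) F))) :
    valuation F X.det = valuation F ϖ ^ (∑ i, a i) := by
  classical
  have hϖ0 := hϖ.ne_zero
  have hϖle : valuation F ϖ ≤ 1 := hϖ.valuation_le_one
  obtain ⟨k, hk, k', hk', h⟩ := hX
  set D := gjPin ϖ (Finset.univ : Finset (Fin n)) a with hD
  have hDdiag : D = Matrix.diagonal fun i => ϖ ^ a i := by
    rw [hD, gjPin]; congr 1; funext i; rw [if_pos (Finset.mem_univ i)]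
  set P₁ : GL (Fin n) F := k * κ with hP₁
  set P₂ : GL (Fin n) F := κ' * k' with hP₂
  have hP₁int : P₁ ∈ glInt n F := Subgroup.mul_mem _ (congruenceGL_le_glInt _ hk) hκ
  have hP₂int : P₂ ∈ glInt n F := Subgroup.mul_mem _ hκ' (congruenceGL_le_glInt _ hk')
  set E := X - (k : Matrix (Fin n) (Fin n) F) * ((κ : Matrix (Fin n) (Fin n) F) * D *
    (κ' : Matrix (Fin n) (Fin n) F)) * (k' : Matrix (Fin n) (Fin n) F) with hE
  set E₁ : Matrix (Fin n) (Fin n) F := ((P₁⁻¹ : GL (Fin n) F) : Matrix (Fin n) (Fin n) F) * E *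
    ((P₂⁻¹ : GL (Fin n) F) : Matrix (Fin n) (Fin n) F) with hE₁
  have hE₁b : ValBound (valuation F ϖ ^ N) E₁ :=
    h.integral_mul_mul (valBound_one_of_mem_glInt (Subgroup.inv_mem _ hP₁int))
      (valBound_one_of_mem_glInt (Subgroup.inv_mem _ hP₂int))
  -- `X = P₁ (D + E₁) P₂`
  have hXeq : X = (P₁ : Matrix (Fin n) (Fin n) F) * (D + E₁) * (P₂ : Matrix (Fin n) (Fin n) F) := by
    rw [Matrix.mul_add, Matrix.add_mul, hE₁]
    have e1 : (P₁ : Matrix (Fin n) (Fin n) F) * (((P₁⁻¹ : GL (Fin n) F) : Matrix (Fin n) (Fin n) F) * E *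
        ((P₂⁻¹ : GL (Fin n) F) : Matrix (Fin n) (Fin n) F)) * (P₂ : Matrix (Fin n) (Fin n) F) = E := by
      rw [← Matrix.mul_assoc, ← Matrix.mul_assoc, ← Units.val_mul, mul_inv_cancel, Units.val_one,
        Matrix.one_mul, Matrix.mul_assoc, ← Units.val_mul, inv_mul_cancel, Units.val_one, Matrix.mul_one]
    rw [e1, hE, hP₁, hP₂, Units.val_mul, Units.val_mul]
    simp only [Matrix.mul_assoc]
    abel
  -- `D + E₁ = D (1 + D⁻¹ E₁)` with `D⁻¹ E₁` of entries `≤ |ϖ|`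
  set Dinv : Matrix (Fin n) (Fin n) F := Matrix.diagonal fun i => (ϖ ^ a i)⁻¹ with hDinv
  have hDDinv : D * Dinv = 1 := by
    rw [hDdiag, hDinv, Matrix.diagonal_mul_diagonal, ← Matrix.diagonal_one]
    congr 1; funext i; exact mul_inv_cancel₀ (pow_ne_zero _ hϖ0)
  have hsmall : ValBound (valuation F ϖ) (Dinv * E₁) := by
    intro i j
    rw [hDinv, Matrix.diagonal_mul, map_mul, map_inv₀, map_pow]
    have hv : valuation F ϖ ^ a i ≠ 0 := valuation_pow_ne_zero' hϖ0 _
    have hle := hE₁b i j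
    obtain ⟨d, hd⟩ : ∃ d, N = a i + (d + 1) := ⟨N - a i - 1, by have := ha i; omega⟩
    rw [hd, pow_add, pow_succ] at hle
    calc (valuation F ϖ ^ a i)⁻¹ * valuation F (E₁ i j)
        ≤ (valuation F ϖ ^ a i)⁻¹ * (valuation F ϖ ^ a i * (valuation F ϖ ^ d * valuation F ϖ)) :=
          mul_le_mul_right hle _
      _ = valuation F ϖ ^ d * valuation F ϖ := by rw [← mul_assoc, inv_mul_cancel₀ hv, one_mul]
      _ ≤ valuation F ϖ := mul_le_of_le_one_left' (pow_le_one' hϖle _)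
  have hdet1 : valuation F (1 + Dinv * E₁).det = 1 :=
    valuation_det_eq_one (by rw [add_sub_cancel_left]; exact hsmall) hϖ.valuation_lt_one
  have hDE : D + E₁ = D * (1 + Dinv * E₁) := by
    rw [Matrix.mul_add, Matrix.mul_one, ← Matrix.mul_assoc, hDDinv, Matrix.one_mul]
  have hdetD : D.det = ϖ ^ (∑ i, a i) := by
    rw [hDdiag, Matrix.det_diagonal, Finset.prod_pow_eq_pow_sum]
  rw [hXeq, hDE, Matrix.det_mul, Matrix.det_mul, Matrix.det_mul, map_mul, map_mul, map_mul,
    valuation_det_eq_one_of_mem_glInt hP₁int, valuation_det_eq_one_of_mem_glInt hP₂int, hdet1, hdetD,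
    map_pow, one_mul, mul_one, mul_one]

end Inputs

end Literature.NumberTheory.Automorphic
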